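import Summits.HodgeConjecture.HodgeCM.PerL34.FockPrintDictionary_3

/-! PORT of `HodgeCM/PerL34/FockPrintDictionary.lean` (HodgeCMPerL run 82) — part 4: continuation of `Summits.HodgeConjecture.HodgeCM.PerL34.FockPrintDictionary_3` (split at a top-level declaration boundary by port_pkg.py; scope re-opened below; declarations unchanged). -/

-- port_pkg: scope re-opened for this part (file-level context, then the namespace/section stack open at the cut)
set_option autoImplicit false
namespace HodgeCM
namespace PerL34
namespace Fock
open MvPolynomial Complex
open scoped BigOperators
namespace PrintDict
section NegativeLine
/-- **MAIN COMPUTATION, negative line (KERNEL)**, every `λ`. -/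
theorem fockOp_rho_single_negWt (lam : ℂ) (k l : HarmVar) :
    fockOp (sf negWt) (ee negWt) (ff negWt) lam (rho negWt (Matrix.single k l 1)) = printedOscNeg lam k l := by
  rcases k with k | ⟨⟩ <;> rcases l with l | ⟨⟩ <;> (try fin_cases k) <;> (try fin_cases l) <;>
    rw [fockOp_apply] <;> simp only [sum_harmVar] <;>
    simp [rho_single_apply, ee, ff, negWt, Pi.single_apply, printedOscNeg, mz_inr_mul_mz_inl,
      dz_inr_mul_dz_inl] <;>
    module

/-- **The conjugate model is the contragredient twist of the package model (KERNEL)**: at `ψ(1) = −i` (the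
conjugate character `ψ̄`) the negative-line operators are `E_{kl} ↦ −osc l k + ½ δ_{kl}`, i.e. `A ↦ oscRep(−Aᵀ) +
½ tr(A)` — the package representation composed with the involution `A ↦ −Aᵀ` (dual module) and twisted by the
inverse vacuum character. -/
theorem printedOscNeg_negI (k l : HarmVar) :
    printedOscNeg (-I) k l = -osc l k + (1 / 2 : ℂ) • (if k = l then 1 else 0) := by
  apply LinearMap.ext
  intro g
  rcases k with k | ⟨⟩ <;> rcases l with l | ⟨⟩ <;> (try fin_cases k) <;> (try fin_cases l) <;>
    simp [printedOscNeg, osc, hE_apply, hH_apply, hP_apply, hQ_apply, hz, hw, Module.End.mul_apply, mul_assoc] <;>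
    module

/-- `A ↦ Σ_{i,j} A_{ji} · osc i j` (= `oscRep ∘ transpose`) as a linear map — bookkeeping for `Module.Basis.ext`. -/
noncomputable def oscLinT : Matrix HarmVar HarmVar ℂ →ₗ[ℂ] Module.End ℂ HarmModel where
  toFun A := ∑ i, ∑ j, A j i • osc i j
  map_add' A A' := by
    simp only [Matrix.add_apply, add_smul, Finset.sum_add_distrib]
  map_smul' c A := by
    simp only [Matrix.smul_apply, smul_eq_mul, mul_smul, Finset.smul_sum, RingHom.id_apply]

/-- (Ported verbatim from the HodgeCMPerL package; no docstring in the source.) -/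
theorem oscLinT_apply (A : Matrix HarmVar HarmVar ℂ) : oscLinT A = ∑ i, ∑ j, A j i • osc i j := rfl

/-- (Ported verbatim from the HodgeCMPerL package; no docstring in the source.) -/
theorem oscLinT_single (k l : HarmVar) (c : ℂ) : oscLinT (Matrix.single k l c) = c • osc l k := by
  simp only [oscLinT_apply, single_apply', ite_and, ite_smul, zero_smul, Finset.sum_ite_eq, Finset.mem_univ,
    if_true]

/-- (Ported verbatim from the HodgeCMPerL package; no docstring in the source.) -/
theorem oscRep_transpose (A : Matrix HarmVar HarmVar ℂ) : oscRep A.transpose = oscLinT A := by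
  rw [oscRep_apply, oscLinT_apply]
  rfl

/-- **THE DICTIONARY for a negative line (KERNEL)**: `fockOp(ρ(A)) = −oscRep(Aᵀ) + ½ tr(A) · 1 =
oscRep(−Aᵀ) + ½ tr(A) · 1` at `ψ(1) = −i`, for all `A ∈ 𝔤𝔩₃(ℂ)`. -/
theorem fockOp_rho_eq_oscRep_negWt (A : Matrix HarmVar HarmVar ℂ) :
    fockOp (sf negWt) (ee negWt) (ff negWt) (-I) (rho negWt A) =
      -oscRep A.transpose + ((1 / 2 : ℂ) * A.trace) • (1 : Module.End ℂ HarmModel) := by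
  let L : Matrix HarmVar HarmVar ℂ →ₗ[ℂ] Module.End ℂ HarmModel :=
    (fockOp (sf negWt) (ee negWt) (ff negWt) (-I)).comp (rhoLin negWt)
  let R : Matrix HarmVar HarmVar ℂ →ₗ[ℂ] Module.End ℂ HarmModel :=
    -oscLinT + (1 / 2 : ℂ) • (Matrix.traceLinearMap HarmVar ℂ ℂ).smulRight (1 : Module.End ℂ HarmModel)
  have hLR : L = R := by
    refine Module.Basis.ext (Matrix.stdBasis ℂ HarmVar HarmVar) fun kl => ?_
    obtain ⟨k, l⟩ := kl
    simp only [L, R, Matrix.stdBasis_eq_single, LinearMap.comp_apply, rhoLin_apply, fockOp_rho_single_negWt,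
      printedOscNeg_negI, LinearMap.add_apply, LinearMap.neg_apply, LinearMap.smul_apply, oscLinT_single,
      one_smul, LinearMap.smulRight_apply, Matrix.traceLinearMap_apply]
    by_cases hkl : k = l
    · subst hkl
      simp [Matrix.trace_single_eq_same]
    · simp [hkl, Matrix.trace_single_eq_of_ne _ _ _ hkl]
  have h := congrArg (fun T => T A) hLR
  simp only [L, R, LinearMap.comp_apply, rhoLin_apply, LinearMap.add_apply, LinearMap.neg_apply,
    LinearMap.smul_apply, LinearMap.smulRight_apply, Matrix.traceLinearMap_apply, smul_smul] at h
  rw [h, oscRep_transpose]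

/-- (Ported verbatim from the HodgeCMPerL package; no docstring in the source.) -/
theorem fockOp_rho_eq_oscRep_negWt' (A : Matrix HarmVar HarmVar ℂ) :
    fockOp (sf negWt) (ee negWt) (ff negWt) (-I) (rho negWt A) =
      oscRep (-A.transpose) + ((1 / 2 : ℂ) * A.trace) • (1 : Module.End ℂ HarmModel) := by
  rw [fockOp_rho_eq_oscRep_negWt, map_neg]

/-- **`U(1)`-part for a negative line (KERNEL)**: the scalars act by `−(weightOp uWt + ½)` for every `λ` — the
`U(1)`-weights are the NEGATIVES of those of the positive-line model (`hpiece k` is the `−(k + ½)`-eigenspace). -/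
theorem fockOp_rho_one_negWt (lam : ℂ) :
    fockOp (sf negWt) (ee negWt) (ff negWt) lam (rho negWt 1) = -(weightOp uWt + (1 / 2 : ℂ) • 1) := by
  rw [weightOp_uWt_eq, fockOp_apply]
  simp only [sum_harmVar]
  simp [Matrix.one_apply, ee, ff, negWt]
  module

/-- (Ported verbatim from the HodgeCMPerL package; no docstring in the source.) -/
theorem mem_hpiece_iff_fockOp_negWt (lam : ℂ) (n : ℤ) (g : HarmModel) :
    g ∈ hpiece n ↔ fockOp (sf negWt) (ee negWt) (ff negWt) lam (rho negWt 1) g = (-((n : ℂ) + 1 / 2)) • g := by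
  rw [mem_wpiece_iff, fockOp_rho_one_negWt, LinearMap.neg_apply, LinearMap.add_apply, LinearMap.smul_apply,
    Module.End.one_apply, neg_smul, add_smul, neg_inj]
  constructor
  · intro h; rw [h]
  · intro h; exact add_right_cancel h

/-- `ρ(𝔤𝔩(V)) ⊂ 𝔰𝔭(W)` for the negative-line form as well (KERNEL). -/
theorem rho_negWt_skew (A : Matrix HarmVar HarmVar ℂ) (x y : Wc HarmVar) :
    sf negWt (rho negWt A x) y + sf negWt x (rho negWt A y) = 0 := by
  simp only [sf_apply, rho_apply_fst, rho_apply_snd, sum_harmVar, negWt]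
  push_cast
  ring

end NegativeLine

end PrintDict

end Fock
end PerL34
end HodgeCM
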